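import Summits.NavierStokesRegularity.FunctionalMining.StretchingLaminateBurkholderConcaveGlue
import Mathlib.Order.ConditionallyCompleteLattice.Basic
import Mathlib.Tactic.Linarith
import HarnessLib

/-!
# FunctionalMining — towards `BurkConcave` (5): LOCAL-TO-GLOBAL concavity on an interval

search for candidate a priori estimates; no regularity claim.  Cell `pub-nsfunc`, prove seat gen 7.  Fifth set of bricks for the
DISCHARGE of the typed hypothesis `Laminate.BurkConcave` (Burkholder 1991, LNM 1464, §8): the architecture lemma that
reduces the concavity of `G(t) = u_λ(x + th, y + tk)` on its interval to PURELY LOCAL statements — concavity on some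
neighbourhood of every point (there: one region formula, or two formulas glued at a seam with the one-sided derivative
test `Burk.concaveOn_Icc_glue_of_deriv` and the seam identities of `…ConcaveSeams`).  CONTENT: `Burk.concaveOn_Icc_of_local`
(on `[a, b]`, by a supremum/continuation argument using `Burk.concaveOn_Icc_union_of_overlap`), `Burk.concaveOn_Ioo_of_Icc`
and `Burk.concaveOn_Ioo_of_local` (the open interval, exhausted by closed ones).  HONEST SIZE: first-year analysis; nothing
about `u_λ` itself is proved here.  Nothing about Navier–Stokes.
-/

noncomputable section

namespace Summit.NavierStokesRegularity.FunctionalMining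

namespace Burk

open Set

/-- **Local-to-global on a closed interval.** If every point `t ∈ [a, b]` has a `δ > 0` such that `f` is concave on
`[max a (t − δ), min b (t + δ)]`, then `f` is concave on `[a, b]` (continuation: the supremum of the right ends `x` with
`f` concave on `[a, x]` is `b`, by gluing on overlaps). [ours; elementary] -/
theorem concaveOn_Icc_of_local {f : ℝ → ℝ} {a b : ℝ} (hab : a ≤ b)
    (hloc : ∀ t ∈ Icc a b, ∃ δ : ℝ, 0 < δ ∧ ConcaveOn ℝ (Icc (max a (t - δ)) (min b (t + δ))) f) :
    ConcaveOn ℝ (Icc a b) f := by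
  obtain ⟨S, hS⟩ : ∃ S : Set ℝ, S = {x | x ∈ Icc a b ∧ ConcaveOn ℝ (Icc a x) f} := ⟨_, rfl⟩
  have memS : ∀ x, x ∈ S ↔ (x ∈ Icc a b ∧ ConcaveOn ℝ (Icc a x) f) := fun x => by rw [hS]; rfl
  have haS : a ∈ S := by
    obtain ⟨δ, hδ, hc⟩ := hloc a (left_mem_Icc.2 hab)
    refine (memS a).2 ⟨left_mem_Icc.2 hab, hc.subset ?_ (convex_Icc a a)⟩
    intro x hx
    exact ⟨max_le hx.1 (by linarith [hx.1]), le_min (hx.2.trans hab) (by linarith [hx.2])⟩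
  have hbdd : BddAbove S := ⟨b, fun x hx => ((memS x).1 hx).1.2⟩
  have hne : S.Nonempty := ⟨a, haS⟩
  have haM : a ≤ sSup S := le_csSup hbdd haS
  have hMb : sSup S ≤ b := csSup_le hne (fun x hx => ((memS x).1 hx).1.2)
  obtain ⟨δ, hδ, hc⟩ := hloc (sSup S) ⟨haM, hMb⟩
  -- concavity on `[a, d]`, `d = min b (sSup S + δ)`
  have hd : ConcaveOn ℝ (Icc a (min b (sSup S + δ))) f := by
    rcases lt_or_ge (sSup S - δ) a with h | h
    · have e : max a (sSup S - δ) = a := max_eq_left h.le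
      rw [e] at hc
      exact hc
    · have e : max a (sSup S - δ) = sSup S - δ := max_eq_right h
      rw [e] at hc
      obtain ⟨x, hxS, hx⟩ := exists_lt_of_lt_csSup hne (show sSup S - δ < sSup S by linarith)
      have hxM : x ≤ sSup S := le_csSup hbdd hxS
      have hx' := (memS x).1 hxS
      exact concaveOn_Icc_union_of_overlap h hx (le_min hx'.1.2 (by linarith)) hx'.2 hc
  have hdS : min b (sSup S + δ) ∈ S := (memS _).2 ⟨⟨le_min hab (by linarith), min_le_left _ _⟩, hd⟩
  have hdM : min b (sSup S + δ) ≤ sSup S := le_csSup hbdd hdS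
  have hbM : b ≤ sSup S := by
    by_contra hcon
    have : sSup S < min b (sSup S + δ) := lt_min (not_le.1 hcon) (by linarith)
    linarith
  have e : min b (sSup S + δ) = b := min_eq_left (by linarith)
  rw [e] at hd
  exact hd

/-- **The open interval from its closed subintervals.** If `f` is concave on `[a, b]` for all `t₀ < a ≤ b < t₁`, then `f`
is concave on `(t₀, t₁)`. [ours; elementary] -/
theorem concaveOn_Ioo_of_Icc {f : ℝ → ℝ} {t₀ t₁ : ℝ}
    (h : ∀ a b : ℝ, t₀ < a → a ≤ b → b < t₁ → ConcaveOn ℝ (Icc a b) f) : ConcaveOn ℝ (Ioo t₀ t₁) f := by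
  refine ⟨convex_Ioo t₀ t₁, fun x hx y hy μ ν hμ hν hμν => ?_⟩
  have hc := h (min x y) (max x y) (lt_min hx.1 hy.1) min_le_max (max_lt hx.2 hy.2)
  exact hc.2 ⟨min_le_left _ _, le_max_left _ _⟩ ⟨min_le_right _ _, le_max_right _ _⟩ hμ hν hμν

/-- **Local-to-global on an open interval.** If every `t ∈ (t₀, t₁)` has a `δ > 0` with `[t − δ, t + δ] ⊆ (t₀, t₁)` and
`f` concave on `[t − δ, t + δ]`, then `f` is concave on `(t₀, t₁)`. [ours; elementary] -/
theorem concaveOn_Ioo_of_local {f : ℝ → ℝ} {t₀ t₁ : ℝ}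
    (hloc : ∀ t ∈ Ioo t₀ t₁, ∃ δ : ℝ, 0 < δ ∧ t₀ < t - δ ∧ t + δ < t₁ ∧ ConcaveOn ℝ (Icc (t - δ) (t + δ)) f) :
    ConcaveOn ℝ (Ioo t₀ t₁) f := by
  refine concaveOn_Ioo_of_Icc fun a b ha hab hb => ?_
  refine concaveOn_Icc_of_local hab fun t ht => ?_
  obtain ⟨δ, hδ, h1, h2, hc⟩ := hloc t ⟨lt_of_lt_of_le ha ht.1, lt_of_le_of_lt ht.2 hb⟩
  refine ⟨δ, hδ, hc.subset ?_ (convex_Icc _ _)⟩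
  exact Icc_subset_Icc (le_max_right _ _) (min_le_right _ _)

end Burk

end Summit.NavierStokesRegularity.FunctionalMining

end
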